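import Summits.AtomisticToContinuum.HydrodynamicLimit.Theorems.InformationPercolationEnginePercolationClosesChaosDockingCells
import Summits.AtomisticToContinuum.HydrodynamicLimit.Theorems.InformationPercolationEnginePercolationClosesChaosCesaroLocalEquilibriumPieces
import HarnessLib

/-!
# Local equilibrium S5 of the line `equilibrium-forecast-chain-rule` (crux `InformationPercolationEngine.PercolationClosesChaos`,
stmt-AtomisticToContinuum-15178) — piece H: the deterministic telescoping floor of the truncated cell entropies

Support file (`--supports stmt-AtomisticToContinuum-15178`) of the registered stub
`stub_cesaroLocalEquilibrium : PredictableProjection → MesoConditionalEquidistribution → LocalCountUI →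
NoMesoscopicOscillation → CoarseLocalMaxwellianity` (worker S5 of lead c3). The conditional coarse H-theorem
(`MesoConditionalEquidistribution` (b)) is spent against the telescoping sum of the truncated smoothed cell entropies
`H_k(z) = h³ Σ_{q ∈ box} min (relEntAt (kΔ) q z, R)` (`h = cℓ_N`): `Σ_{k<K} (H_{k+1} − H_k) = H_K − H_0 ≥ −H_0 ≥ −27 R`,
deterministically, for every phase point. This file proves exactly that, over the tree vocabulary:

* `relEnt_nonneg`, `relEnt_empty`, `relEntAt_nonneg`, `relEntAt_eq_zero_of_not_mem` — the Gibbs floor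
  (`relEnt_nonneg_unfolded`, p123945) in the skeleton's own terms, and the vanishing of `relEntAt` off the finite cell box
  (no sphere has its cell outside `cellBox h`, `cellOf_mem_cellBox`; the empty population has `kde = 0`);
* the realised increment `Y_{k,q} = min(relEntAt((k+1)Δ) q, R) − min(relEntAt(kΔ) q, R)` of the line (written out, no new
  definition): `abs_entropyIncrement_le` (`|Y| ≤ R`), `entropyIncrement_eq_zero_of_not_mem` (box support);
* `sum_entropyIncrement_ge` (registered helper, the headline): `−27 R ≤ h³ Σ_{k<K} Σ_{q ∈ cellBox h} Y_{k,q}(z)` for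
  `0 ≤ R`, `0 < h ≤ 1`, every `K`, `z` (telescope in `k`, floor `min ≥ 0`, ceiling `min ≤ R`, `h³ · #box ≤ 27`);
* `unitAvg_entropyIncrement_ge`: the same in the unit-average currency, `−27R/K_N ≤ unitAvg Y`;
* unit bookkeeping for box-supported families: `unitAvg_add'`, `unitAvg_const_mul'`, `unitAvg_le_mul_of_le`
  (`F ≤ M` ⇒ `unitAvg F ≤ 27 M`), `unitAvg_split` (regular/irregular split of a unit average).

Elementary (finite sums); no dynamics beyond the definitions.
-/

noncomputable section

open MeasureTheory Set Filter Topology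
open scoped ENNReal BigOperators Classical
open Literature.Analysis.FluidPDE Literature.MathematicalPhysics.KineticTheory
open Literature.MathematicalPhysics.KineticTheory.VelocityBlindPlacement

namespace Summit.AtomisticToContinuum.HydrodynamicLimit.Theorems.EquilibriumForecastLine

/-! ## The Gibbs floor and the box support of the cell entropies -/

/-- **`0 ≤ relEnt ϑ w P`** for every smoothing, configuration and population (the landed `relEnt_nonneg_unfolded`
read through the definitions of `relEnt`, `kde`, `temp`, `meanVel`). [folklore] -/
theorem relEnt_nonneg {N : ℕ} (ϑ : ℝ) (w : Phase N) (P : Finset (Fin (N + 1))) : 0 ≤ relEnt ϑ w P := by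
  unfold relEnt kde temp meanVel
  exact relEnt_nonneg_unfolded ϑ w P

/-- The smoothed velocity law of the empty population vanishes identically. [folklore] -/
theorem kde_empty_eq {N : ℕ} (ϑ : ℝ) (w : Phase N) (v : V3) : kde ϑ w ∅ v = 0 := by
  simp [kde]

/-- The smoothed relative entropy of the empty population is `0`. [folklore] -/
theorem relEnt_empty {N : ℕ} (ϑ : ℝ) (w : Phase N) : relEnt ϑ w ∅ = 0 := by
  simp [relEnt, kde_empty_eq]

/-- A cell outside the box has empty population (every sphere's cell is in the box). [folklore] -/
theorem pop_eq_empty_of_not_mem {c σ : ℝ} {N : ℕ} (h : 0 < c * meanFreePath σ N) (w : Phase N) {q : Cell}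
    (hq : q ∉ cellBox (c * meanFreePath σ N)) : pop c σ N w q = ∅ := by
  unfold pop
  refine Finset.filter_eq_empty_iff.2 fun i _ hi => hq ?_
  rw [← hi]
  exact cellOf_mem_cellBox h _

/-- `relEntAt` is nonnegative. [folklore] -/
theorem relEntAt_nonneg {σ : ℝ} {N : ℕ} (ϑs c : ℝ) (Φ : Flow σ N) (t : ℝ) (q : Cell) (z : Phase N) :
    0 ≤ relEntAt ϑs c σ N Φ t q z :=
  relEnt_nonneg _ _ _

/-- `relEntAt` vanishes at cells outside the box. [folklore] -/
theorem relEntAt_eq_zero_of_not_mem {c σ : ℝ} {N : ℕ} (h : 0 < c * meanFreePath σ N) (ϑs : ℝ) (Φ : Flow σ N)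
    (t : ℝ) {q : Cell} (hq : q ∉ cellBox (c * meanFreePath σ N)) (z : Phase N) :
    relEntAt ϑs c σ N Φ t q z = 0 := by
  unfold relEntAt
  rw [pop_eq_empty_of_not_mem h _ hq, relEnt_empty]

/-! ## The realised entropy increment of a unit -/

/-! The REALISED INCREMENT of the line's H-functional at unit `(k, q)` is written out everywhere below as
`Y_{k,q} = min (relEntAt ϑs c σ N Φ ((k+1)Δ) q z) R − min (relEntAt ϑs c σ N Φ (kΔ) q z) R` (the first two summands of
the quantity whose `G_N`-forecast `MesoConditionalEquidistribution` (b) controls); no abbreviation is introduced. -/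

/-- Truncated nonnegative quantities differ by at most the truncation level: `|Y_{k,q}| ≤ R` (`0 ≤ R`). [folklore] -/
theorem abs_entropyIncrement_le {σ : ℝ} {N : ℕ} (ϑs : ℝ) {R : ℝ} (hR : 0 ≤ R) (c : ℝ) (Φ : Flow σ N) (k : ℕ)
    (q : Cell) (z : Phase N) :
    |min (relEntAt ϑs c σ N Φ (((k : ℝ) + 1) * stepLen c σ N) q z) R -
      min (relEntAt ϑs c σ N Φ ((k : ℝ) * stepLen c σ N) q z) R| ≤ R := by
  have h1 := relEntAt_nonneg ϑs c Φ (((k : ℝ) + 1) * stepLen c σ N) q z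
  have h0 := relEntAt_nonneg ϑs c Φ ((k : ℝ) * stepLen c σ N) q z
  rw [abs_le]
  constructor
  · have := min_le_right (relEntAt ϑs c σ N Φ ((k : ℝ) * stepLen c σ N) q z) R
    have := le_min h1 hR
    linarith
  · have := min_le_right (relEntAt ϑs c σ N Φ (((k : ℝ) + 1) * stepLen c σ N) q z) R
    have := le_min h0 hR
    linarith

/-- The increment vanishes off the box. [folklore] -/
theorem entropyIncrement_eq_zero_of_not_mem {c σ : ℝ} {N : ℕ} (h : 0 < c * meanFreePath σ N) (ϑs R : ℝ)
    (Φ : Flow σ N) (k : ℕ) {q : Cell} (hq : q ∉ cellBox (c * meanFreePath σ N)) (z : Phase N) :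
    min (relEntAt ϑs c σ N Φ (((k : ℝ) + 1) * stepLen c σ N) q z) R -
      min (relEntAt ϑs c σ N Φ ((k : ℝ) * stepLen c σ N) q z) R = 0 := by
  rw [relEntAt_eq_zero_of_not_mem h ϑs Φ _ hq, relEntAt_eq_zero_of_not_mem h ϑs Φ _ hq, sub_self]

/-! ## The telescoping floor -/

/-- Telescoping of the truncated entropy of ONE cell over `K` steps: the sum of its increments is
`min(relEntAt(KΔ), R) − min(relEntAt(0), R) ≥ −R` (`0 ≤ R`). [folklore] -/
theorem sum_range_entropyIncrement_ge {σ : ℝ} {N : ℕ} (ϑs : ℝ) {R : ℝ} (hR : 0 ≤ R) (c : ℝ) (Φ : Flow σ N)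
    (K : ℕ) (q : Cell) (z : Phase N) :
    -R ≤ ∑ k ∈ Finset.range K, (min (relEntAt ϑs c σ N Φ (((k : ℝ) + 1) * stepLen c σ N) q z) R -
      min (relEntAt ϑs c σ N Φ ((k : ℝ) * stepLen c σ N) q z) R) := by
  set a : ℕ → ℝ := fun k => min (relEntAt ϑs c σ N Φ ((k : ℝ) * stepLen c σ N) q z) R with ha
  have hterm : ∀ k : ℕ, min (relEntAt ϑs c σ N Φ (((k : ℝ) + 1) * stepLen c σ N) q z) R -
      min (relEntAt ϑs c σ N Φ ((k : ℝ) * stepLen c σ N) q z) R = a (k + 1) - a k := by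
    intro k
    simp only [ha, Nat.cast_succ]
  rw [Finset.sum_congr rfl fun k _ => hterm k, Finset.sum_range_sub]
  have hK : 0 ≤ a K := le_min (relEntAt_nonneg ϑs c Φ _ q z) hR
  have h0 : a 0 ≤ R := min_le_right _ _
  linarith

/-- **Registered helper `sum_entropyIncrement_ge` (piece H of S5): the deterministic telescoping floor.** For `0 ≤ R`,
`0 < h = cℓ_N ≤ 1`, every number of steps `K` and every phase point `z`,
`−27 R ≤ h³ Σ_{k<K} Σ_{q ∈ cellBox h} (min(relEntAt((k+1)Δ) q z, R) − min(relEntAt(kΔ) q z, R))`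
(telescope each cell: `≥ −R`; `h³ · #cellBox h ≤ 27`). [folklore] -/
theorem sum_entropyIncrement_ge : ∀ {σ : ℝ} {N : ℕ} (Φ : Flow σ N) (ϑs R c : ℝ) (K : ℕ) (z : Phase N), 0 ≤ R → 0 < c * meanFreePath σ N → c * meanFreePath σ N ≤ 1 → -(27 * R) ≤ (c * meanFreePath σ N) ^ 3 * ∑ k ∈ Finset.range K, ∑ q ∈ cellBox (c * meanFreePath σ N), (min (relEntAt ϑs c σ N Φ (((k : ℝ) + 1) * stepLen c σ N) q z) R - min (relEntAt ϑs c σ N Φ ((k : ℝ) * stepLen c σ N) q z) R) := by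
  intro σ N Φ ϑs R c K z hR h0 h1
  rw [Finset.sum_comm]
  have hcell : ∀ q ∈ cellBox (c * meanFreePath σ N),
      -R ≤ ∑ k ∈ Finset.range K, (min (relEntAt ϑs c σ N Φ (((k : ℝ) + 1) * stepLen c σ N) q z) R -
        min (relEntAt ϑs c σ N Φ ((k : ℝ) * stepLen c σ N) q z) R) :=
    fun q _ => sum_range_entropyIncrement_ge ϑs hR c Φ K q z
  have hsum : -(R * (cellBox (c * meanFreePath σ N)).card) ≤
      ∑ q ∈ cellBox (c * meanFreePath σ N), ∑ k ∈ Finset.range K,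
        (min (relEntAt ϑs c σ N Φ (((k : ℝ) + 1) * stepLen c σ N) q z) R -
          min (relEntAt ϑs c σ N Φ ((k : ℝ) * stepLen c σ N) q z) R) := by
    have h := Finset.sum_le_sum hcell
    rw [Finset.sum_const, nsmul_eq_mul] at h
    linarith
  have hbox := card_cellBox_mul_le h0 h1
  have h3 : 0 ≤ (c * meanFreePath σ N) ^ 3 := by positivity
  calc -(27 * R) ≤ -((c * meanFreePath σ N) ^ 3 * ((cellBox (c * meanFreePath σ N)).card : ℝ) * R) := by
        nlinarith
    _ = (c * meanFreePath σ N) ^ 3 * -(R * (cellBox (c * meanFreePath σ N)).card) := by ring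
    _ ≤ _ := mul_le_mul_of_nonneg_left hsum h3

/-- The telescoping floor in the unit-average currency: `−27R/K_N ≤ unitAvg Y` (`Y = entropyIncrement`, box-supported;
for `K_N = 0` both sides vanish). [folklore] -/
theorem unitAvg_entropyIncrement_ge {σ : ℝ} {N : ℕ} (Φ : Flow σ N) (ϑs : ℝ) {R c : ℝ} (τ : ℝ) (z : Phase N)
    (hR : 0 ≤ R) (h0 : 0 < c * meanFreePath σ N) (h1 : c * meanFreePath σ N ≤ 1) :
    -(27 * R) / numSteps c σ N τ ≤ unitAvg c σ N τ fun k q =>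
      min (relEntAt ϑs c σ N Φ (((k : ℝ) + 1) * stepLen c σ N) q z) R -
        min (relEntAt ϑs c σ N Φ ((k : ℝ) * stepLen c σ N) q z) R := by
  rw [unitAvg_eq_sum c σ N τ _ fun k q hq => entropyIncrement_eq_zero_of_not_mem h0 ϑs R Φ k hq z]
  have h := sum_entropyIncrement_ge Φ ϑs R c (numSteps c σ N τ) z hR h0 h1
  set S := ∑ k ∈ Finset.range (numSteps c σ N τ), ∑ q ∈ cellBox (c * meanFreePath σ N),
    (min (relEntAt ϑs c σ N Φ (((k : ℝ) + 1) * stepLen c σ N) q z) R -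
      min (relEntAt ϑs c σ N Φ ((k : ℝ) * stepLen c σ N) q z) R) with hS
  rcases Nat.eq_zero_or_pos (numSteps c σ N τ) with hK | hK
  · simp [hK]
  have hKpos : (0 : ℝ) < numSteps c σ N τ := by exact_mod_cast hK
  rw [div_le_iff₀ hKpos]
  calc -(27 * R) ≤ (c * meanFreePath σ N) ^ 3 * S := h
    _ = _ := by field_simp

/-! ## Unit bookkeeping for box-supported families -/

/-- Additivity of the unit average on box-supported families. [folklore] -/
theorem unitAvg_add' {c σ : ℝ} {N : ℕ} (τ : ℝ) {F G : ℕ → Cell → ℝ}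
    (hF : ∀ k, ∀ q ∉ cellBox (c * meanFreePath σ N), F k q = 0)
    (hG : ∀ k, ∀ q ∉ cellBox (c * meanFreePath σ N), G k q = 0) :
    unitAvg c σ N τ (fun k q => F k q + G k q) = unitAvg c σ N τ F + unitAvg c σ N τ G := by
  rw [unitAvg_eq_sum c σ N τ F hF, unitAvg_eq_sum c σ N τ G hG,
    unitAvg_eq_sum c σ N τ _ fun k q hq => by rw [hF k q hq, hG k q hq, add_zero]]
  simp only [Finset.sum_add_distrib]
  ring

/-- Homogeneity of the unit average (any family: `tsum_mul_left` is unconditional over `ℝ`). [folklore] -/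
theorem unitAvg_const_mul' (c σ : ℝ) (N : ℕ) (τ a : ℝ) (F : ℕ → Cell → ℝ) :
    unitAvg c σ N τ (fun k q => a * F k q) = a * unitAvg c σ N τ F := by
  unfold unitAvg
  simp only [tsum_mul_left, ← Finset.mul_sum]
  ring

/-- A box-supported family bounded by `M ≥ 0` has unit average at most `27 M` (`0 < h ≤ 1`). [folklore] -/
theorem unitAvg_le_mul_of_le {c σ : ℝ} {N : ℕ} (τ : ℝ) {F : ℕ → Cell → ℝ} {M : ℝ} (hM : 0 ≤ M)
    (h0 : 0 < c * meanFreePath σ N) (h1 : c * meanFreePath σ N ≤ 1)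
    (hF : ∀ k, ∀ q ∉ cellBox (c * meanFreePath σ N), F k q = 0) (hFM : ∀ k q, F k q ≤ M) :
    unitAvg c σ N τ F ≤ 27 * M := by
  rw [unitAvg_eq_sum c σ N τ F hF]
  have hbox := card_cellBox_mul_le h0 h1
  rcases Nat.eq_zero_or_pos (numSteps c σ N τ) with hK | hK
  · simp only [hK, Finset.sum_range_zero, mul_zero]
    positivity
  have hKpos : (0 : ℝ) < numSteps c σ N τ := by exact_mod_cast hK
  have hsum : ∑ k ∈ Finset.range (numSteps c σ N τ), ∑ q ∈ cellBox (c * meanFreePath σ N), F k q ≤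
      (numSteps c σ N τ : ℝ) * ((cellBox (c * meanFreePath σ N)).card * M) := by
    have h : ∀ k ∈ Finset.range (numSteps c σ N τ),
        ∑ q ∈ cellBox (c * meanFreePath σ N), F k q ≤ (cellBox (c * meanFreePath σ N)).card * M := by
      intro k _
      have := Finset.sum_le_sum fun q (_ : q ∈ cellBox (c * meanFreePath σ N)) => hFM k q
      rwa [Finset.sum_const, nsmul_eq_mul] at this
    have := Finset.sum_le_sum h
    rwa [Finset.sum_const, Finset.card_range, nsmul_eq_mul] at this
  have h3 : 0 ≤ (c * meanFreePath σ N) ^ 3 := by positivity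
  calc ((numSteps c σ N τ : ℝ))⁻¹ * (c * meanFreePath σ N) ^ 3 *
        ∑ k ∈ Finset.range (numSteps c σ N τ), ∑ q ∈ cellBox (c * meanFreePath σ N), F k q
      ≤ ((numSteps c σ N τ : ℝ))⁻¹ * (c * meanFreePath σ N) ^ 3 *
        ((numSteps c σ N τ : ℝ) * ((cellBox (c * meanFreePath σ N)).card * M)) :=
        mul_le_mul_of_nonneg_left hsum (by positivity)
    _ = (c * meanFreePath σ N) ^ 3 * (cellBox (c * meanFreePath σ N)).card * M := by
        field_simp
    _ ≤ 27 * M := mul_le_mul_of_nonneg_right hbox hM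

/-- **The regular/irregular split of a unit average**: for a box-supported family and any predicate on units,
`unitAvg F = unitAvg (F · 𝟙_P) + unitAvg (F · 𝟙_{¬P})`. [folklore] -/
theorem unitAvg_split {c σ : ℝ} {N : ℕ} (τ : ℝ) {F : ℕ → Cell → ℝ} (P : ℕ → Cell → Prop)
    (hF : ∀ k, ∀ q ∉ cellBox (c * meanFreePath σ N), F k q = 0) :
    unitAvg c σ N τ F = unitAvg c σ N τ (fun k q => if P k q then F k q else 0) +
      unitAvg c σ N τ (fun k q => if P k q then 0 else F k q) := by
  rw [← unitAvg_add' τ (fun k q hq => by simp [hF k q hq]) (fun k q hq => by simp [hF k q hq])]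
  congr 1
  funext k q
  split_ifs <;> simp

/-- The irregular part of a bounded split is controlled by the irregular unit-fraction INSIDE THE BOX:
`unitAvg (F · 𝟙_{¬P}) ≤ M · unitAvg 𝟙_{box ∧ ¬P}` for a box-supported `F ≤ M`. [folklore] -/
theorem unitAvg_split_le {c σ : ℝ} {N : ℕ} (τ : ℝ) {F : ℕ → Cell → ℝ} (P : ℕ → Cell → Prop) {M : ℝ}
    (h0 : 0 ≤ c * meanFreePath σ N) (hF : ∀ k, ∀ q ∉ cellBox (c * meanFreePath σ N), F k q = 0)
    (hFM : ∀ k q, F k q ≤ M) :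
    unitAvg c σ N τ (fun k q => if P k q then 0 else F k q) ≤
      M * unitAvg c σ N τ (fun k q => if q ∈ cellBox (c * meanFreePath σ N) ∧ ¬ P k q then 1 else 0) := by
  rw [← unitAvg_const_mul']
  refine unitAvg_mono h0 (fun k q hq => by simp [hF k q hq]) (fun k q hq => by simp [hq]) fun k q => ?_
  by_cases hq : q ∈ cellBox (c * meanFreePath σ N)
  · by_cases hP : P k q
    · simp [hP]
    · simp [hP, hq, hFM k q]
  · simp [hq, hF k q hq]

end Summit.AtomisticToContinuum.HydrodynamicLimit.Theorems.EquilibriumForecastLine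

end
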